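import Literature.NumberTheory.EllipticCurves.UniversalOrdinaryEllipticProofs
import Literature.RingTheory.DiscreteValuationRing.PrimeElementLocalization
import HarnessLib

/-!
# The discrete valuation ring `R̂_(p)` of the universal ordinary base at `(p)` (proofs only)

Trunk T-NT-EC (Literature/NumberTheory/EllipticCurves). For Blakestad–Grant's base ring
`R̂ = ℤ[A₄,A₆][1/H]^∧_p` (`UniversalOrdinaryRing`; J. Number Theory 249 (2023), §2.1) and
`p ≥ 5`, the prime ideal `(p) ⊂ R̂` is principal with `R̂/p = 𝔽_p[A₄,A₆][1/H]` a domain, and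
`R̂` is `p`-adically separated; so the local ring `V = R̂_(p)` (Mathlib
`Localization.AtPrime (Ideal.span {(p : R̂)})`) is a DISCRETE VALUATION RING with uniformizer
`p`, fraction field `K = Frac R̂` and residue field `𝔽_p(A₄,A₆)`
(`isDiscreteValuationRing_localizationAtPrime`, from the tree's generic
`Literature.RingTheory.DiscreteValuationRing.isDiscreteValuationRing_of_forall_exists_not_pow_dvd`).
This is the normal local ring through which `p`-integrality statements over `R̂` are proved
and then descended (`pᵏV ∩ R̂ = pᵏR̂`,
`Literature.RingTheory.DiscreteValuationRing.pow_dvd_of_pow_dvd_algebraMap`): Blakestad–Grant's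
"every elementary symmetric function in the roots of `φ_ψ(x)` lies in `R̂`", "Gauss's lemma gives
(6)" (proof of Prop. 7) are statements about the valuation of `V`, `R̂` itself not being known
to be normal. Contents (`p ≥ 5`; the instance arguments `[IsDomain R̂]`,
`[(Ideal.span {p}).IsPrime]` are the tree's `isDomain_completeRing`,
`span_natCast_isPrime_completeRing`):

* `exists_not_pow_dvd_completeRing` — finite `p`-multiplicities (`R̂` is `p`-adically separated;
  `p ≠ 0` in `R̂` is the tree's `natCast_prime_ne_zero`, `UniversalOrdinaryFunctionalEquation`);
* `isDiscreteValuationRing_localizationAtPrime`, `isIntegrallyClosed_localizationAtPrime`;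
* `pow_dvd_of_pow_dvd_algebraMap_completeRing` — `pᵏR̂_(p) ∩ R̂ = pᵏR̂`;
* `isUnit_natCast_completeRing`, `isUnit_three_completeRing`, `not_natCast_dvd_two_completeRing`
  — `m ∈ R̂ˣ` for `0 < m < p`; `3 ∈ R̂ˣ`, `p ∤ 2` (the hypotheses `h3`, `h2` of
  `VeluKernelReductionProofs`).

## Sources

* C. Blakestad, D. Grant, J. Number Theory 249 (2023) 348–376 (arXiv:1903.02480), §2.1, proof
  of Prop. 7. [BlakestadGrant2023]
* N. Bourbaki, *Commutative Algebra*, VI §3 no. 6, Prop. 9. [Bourbaki1989CommAlg]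

Pure proof file: no definitions, no named facts.
-/

noncomputable section

namespace Literature.NumberTheory.EllipticCurves.UniversalOrdinary

open Literature.RingTheory.DiscreteValuationRing

variable (p : ℕ) [Fact p.Prime]

omit [Fact p.Prime] in
/-- **Finite `p`-multiplicities in `R̂`**: every `x ≠ 0` has some `pⁿ ∤ x` (`R̂` is `p`-adically
complete, hence separated). [folklore] -/
theorem exists_not_pow_dvd_completeRing {x : completeRing p} (hx : x ≠ 0) :
    ∃ n, ¬(p : completeRing p) ^ n ∣ x :=
  exists_not_pow_dvd_of_isHausdorff (p : completeRing p) hx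

/-- **`R̂_(p)` is a discrete valuation ring** with uniformizer `p` (`p ≥ 5`).
[Bourbaki AC VI §3 no. 6, Prop. 9] [cite: Bourbaki1989CommAlg, VI §3 no. 6 Prop. 9] -/
theorem isDiscreteValuationRing_localizationAtPrime [IsDomain (completeRing p)]
    [(Ideal.span {(p : completeRing p)}).IsPrime] (hp5 : 5 ≤ p) :
    IsDiscreteValuationRing (Localization.AtPrime (Ideal.span {(p : completeRing p)})) :=
  isDiscreteValuationRing_of_forall_exists_not_pow_dvd (p : completeRing p)
    (natCast_prime_ne_zero p hp5) fun _ hx => exists_not_pow_dvd_completeRing p hx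

/-- Hence `R̂_(p)` is integrally closed (`p ≥ 5`). [folklore] -/
theorem isIntegrallyClosed_localizationAtPrime [IsDomain (completeRing p)]
    [(Ideal.span {(p : completeRing p)}).IsPrime] (hp5 : 5 ≤ p) :
    IsIntegrallyClosed (Localization.AtPrime (Ideal.span {(p : completeRing p)})) :=
  isIntegrallyClosed_localization (p : completeRing p) (natCast_prime_ne_zero p hp5)
    fun _ hx => exists_not_pow_dvd_completeRing p hx

/-- **`pᵏR̂_(p) ∩ R̂ = pᵏR̂`** (`p ≥ 5`): divisibility by `pᵏ` descends from the discrete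
valuation ring `R̂_(p)` to `R̂`. [folklore] -/
theorem pow_dvd_of_pow_dvd_algebraMap_completeRing [IsDomain (completeRing p)]
    [(Ideal.span {(p : completeRing p)}).IsPrime] (hp5 : 5 ≤ p) {a : completeRing p} {k : ℕ}
    (h : algebraMap (completeRing p) (Localization.AtPrime (Ideal.span {(p : completeRing p)})) p ^ k ∣
      algebraMap (completeRing p) (Localization.AtPrime (Ideal.span {(p : completeRing p)})) a) :
    (p : completeRing p) ^ k ∣ a :=
  pow_dvd_of_pow_dvd_algebraMap (p : completeRing p) (natCast_prime_ne_zero p hp5) h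

/-- **`m ∈ R̂ˣ` for `0 < m < p`**: `m` is prime to `p`, hence a unit of the `p`-adically complete
ring `R̂`. [folklore] -/
theorem isUnit_natCast_completeRing {m : ℕ} (hm0 : 0 < m) (hmp : m < p) :
    IsUnit ((m : ℕ) : completeRing p) := by
  have hp : p.Prime := Fact.out
  have hcop : Nat.Coprime p m := (Nat.Prime.coprime_iff_not_dvd hp).mpr fun h =>
    absurd (Nat.le_of_dvd hm0 h) (not_le.mpr hmp)
  exact isUnit_natCast_of_coprime hcop.symm

/-- `3 ∈ R̂ˣ` (`p ≥ 5`; the hypothesis `h3` of `VeluKernelReductionProofs`). [folklore] -/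
theorem isUnit_three_completeRing (hp5 : 5 ≤ p) : IsUnit (3 : completeRing p) := by
  have := isUnit_natCast_completeRing p (m := 3) (by norm_num) (by omega)
  exact_mod_cast this

/-- `p ∤ 2` in `R̂` (`p ≥ 5`; the hypothesis `h2` of `VeluKernelReductionProofs`). [folklore] -/
theorem not_natCast_dvd_two_completeRing (hp5 : 5 ≤ p) : ¬(p : completeRing p) ∣ 2 := by
  intro h
  have h2 : IsUnit (2 : completeRing p) := by
    have := isUnit_natCast_completeRing p (m := 2) (by norm_num) (by omega)
    exact_mod_cast this
  exact natCast_mem_nonunits p hp5 (isUnit_of_dvd_unit h h2)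

end Literature.NumberTheory.EllipticCurves.UniversalOrdinary
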